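import Literature.Computability.AlgebraicComplexity.CircuitDepthProductDepthOne
import Literature.Computability.AlgebraicComplexity.BurgisserBooleanPartsA3Steps
import Mathlib.Algebra.MvPolynomial.Degrees
import HarnessLib

/-!
# `ΣΠΣ` circuits in the tree's circuit model: builder, wire count, restriction of variables

Topic `Literature/Computability/AlgebraicComplexity`; support file for the discharge of the named
fact `sigmaPiSigma_edgeSize_le_of_complexity` (`DepthThreeChasm.lean`: Gupta–Kamath–Kayal–
Saptharishi, *Arithmetic circuits: a chasm at depth three*, ECCC TR13-026 = SIAM J. Comput. 45
(2016), Thm. 1.1). This file is the circuit plumbing in the list-based model `ArithCircuit`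
(`ArithCircuit.lean`, `CircuitDepth.lean`: unbounded-fan-in weighted-sum and product gates,
`productDepth`, `edgeSize` = number of wires), reusing the layer bookkeeping of
`DepthReductionProofs.lean` (`gateValues_layer`, `gateWDepths_layer`, `foldr_max_le`,
`depthIn_le`) and the `ΣΠ` circuit `ArithCircuit.sumOfMonomials` of
`CircuitDepthProductDepthOne.lean`:

* `edgeSize_sumOfMonomials`: the `ΣΠ` circuit of `f` along `ms` has `∑_{m ∈ ms} |m| + #ms` wires.
* Affine forms `affVal (a, b) = ∑_j a_j X_j + b` and their gates `affGate` (`#σ + 1` wires); the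
  `ΣΠΣ` builder `spsCircuit T D c ℓ` computing `∑_{τ<T} c_τ ∏_{π<D} ℓ_{τπ}` (GKKS TR13-026 eq. (1):
  "`C = ∑_i ∏_j ℓ_{ij}(x)` where each `ℓ_{ij}` is an affine form") with product-depth `≤ 1` and
  `T · D · (#σ + 1) + T · D + T` wires (`eval_spsCircuit`, `productDepth_spsCircuit_le`,
  `edgeSize_spsCircuit`), and its list-fed form `exists_sps_circuit`.
* Renaming: `edgeSize_rename`, `productDepth_rename` (renaming variables changes neither wires
  nor product-depth).
* Restriction to the variables that occur: `exists_restrict` — every circuit is the renaming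
  along `Subtype.val` of a circuit over the finite set of variables occurring in it, a set of
  size `≤ edgeSize + 1` (GKKS count wires including input wires, so their `s` dominates the number
  of variables actually read; in the tree `complexity` does not, and this lemma recovers it).
* `totalDegree_rename_of_injective`; `card_support_le_pow_of_totalDegree_le` (at most
  `(D+1)^{#σ}` monomials of degree `≤ D`). (That a fan-in-two circuit with `s` gates computes a
  polynomial of degree `≤ 2^s` is `totalDegree_eval_le_two_pow_size` of
  `BurgisserBooleanPartsA3Steps.lean`, reused downstream, not re-proved here.)

Nothing here is a named fact; everything is proved (D-0026).

## References

* A. Gupta, P. Kamath, N. Kayal, R. Saptharishi, *Arithmetic circuits: a chasm at depth three*,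
  ECCC TR13-026 (2013) = SIAM J. Comput. 45(3) (2016): §1 eq. (1) (`ΣΠΣ` circuits), §3 (size =
  number of wires).
* N. Limaye, S. Srinivasan, S. Tavenas, *Superpolynomial lower bounds against low-depth
  algebraic circuits*, FOCS 2021, §1–§2 (product-depth, edge size).
* P. Bürgisser, *Completeness and Reduction in Algebraic Complexity Theory*, Springer 2000,
  Def. 2.1, Rem. 2.2 (renaming).
-/

noncomputable section

open MvPolynomial

namespace Literature.Computability.AlgebraicComplexity.DepthThreeChasm

universe u v w

variable {k : Type u} {σ : Type v} {τ : Type w}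

open ArithCircuit DepthReduction

/-! ## Wires of the `ΣΠ` circuit -/

section SumOfMonomials

variable [CommSemiring k]

omit [CommSemiring k] in
/-- A monomial gate has one wire per variable occurrence: `fanIn = |m|`. [cite: LST2021, §2] -/
theorem fanIn_monomialGate (m : σ →₀ ℕ) :
    (monomialGate m : Gate k σ).fanIn = Multiset.card (Finsupp.toMultiset m) := by
  simp [monomialGate, Gate.fanIn, Gate.args, Multiset.length_toList]

/-- A piece gate along `ms` has `#ms` wires. [cite: LST2021, §2] -/
theorem fanIn_pieceGate (ms : List (σ →₀ ℕ)) (q : MvPolynomial σ k) :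
    (pieceGate ms q : Gate k σ).fanIn = ms.length := by
  simp [pieceGate, Gate.fanIn, Gate.args]

/-- Wire count of the `ΣΠ` circuit: `∑_{m ∈ ms} |m| + #ms`. [cite: LST2021, §2] -/
theorem edgeSize_sumOfMonomials (ms : List (σ →₀ ℕ)) (f : MvPolynomial σ k) :
    (sumOfMonomials ms f).edgeSize =
      (ms.map fun m => Multiset.card (Finsupp.toMultiset m)).sum + ms.length := by
  simp [sumOfMonomials, ArithCircuit.edgeSize, layerM, List.map_map, Function.comp_def,
    fanIn_monomialGate, fanIn_pieceGate, List.sum_append]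

/-- If every monomial of `ms` has degree `≤ D`, the `ΣΠ` circuit has at most `#ms · (D + 1)`
wires. [cite: LST2021, §2] -/
theorem edgeSize_sumOfMonomials_le {ms : List (σ →₀ ℕ)} (f : MvPolynomial σ k) {D : ℕ}
    (h : ∀ m ∈ ms, Multiset.card (Finsupp.toMultiset m) ≤ D) :
    (sumOfMonomials ms f).edgeSize ≤ ms.length * (D + 1) := by
  rw [edgeSize_sumOfMonomials]
  have : (ms.map fun m => Multiset.card (Finsupp.toMultiset m)).sum ≤ ms.length * D := by
    have := List.sum_le_card_nsmul (ms.map fun m => Multiset.card (Finsupp.toMultiset m)) D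
      (fun x hx => by
        obtain ⟨m, hm, rfl⟩ := List.mem_map.1 hx
        exact h m hm)
    simpa [List.length_map, smul_eq_mul] using this
  nlinarith

/-- The `ΣΠ` circuit of `f` along its support: `∑_{m ∈ supp f} coeff_m X^m` computes `f` with
product-depth `≤ 1` and at most `#supp f · (deg f + 1)` wires. [cite: LST2021, §1–§2] -/
theorem exists_sumOfMonomials_circuit (f : MvPolynomial σ k) :
    ∃ C : ArithCircuit k σ, C.eval = f ∧ C.productDepth ≤ 1 ∧
      C.edgeSize ≤ f.support.card * (f.totalDegree + 1) := by
  refine ⟨sumOfMonomials f.support.toList f,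
    eval_sumOfMonomials (Finset.nodup_toList _) (fun _ hm => Finset.mem_toList.mpr hm),
    productDepth_sumOfMonomials_le _ _, ?_⟩
  rw [← Finset.length_toList]
  refine edgeSize_sumOfMonomials_le f fun m hm => ?_
  rw [Finsupp.card_toMultiset]
  exact le_totalDegree (Finset.mem_toList.1 hm)

end SumOfMonomials

/-! ## Affine forms and the `ΣΠΣ` builder -/

section Builder

variable [CommSemiring k] [Fintype σ]

/-- The affine form `∑_j a_j X_j + b` with coefficient vector `a` and constant `b`
(GKKS TR13-026 §1, eq. (1): "each `ℓ_{ij}(x)` is an affine form over the input variables").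
[cite: GuptaKamathKayalSaptharishi2016, §1 eq. (1)] -/
def affVal (φ : (σ → k) × k) : MvPolynomial σ k :=
  (∑ j, φ.1 j • X j) + C φ.2

/-- Unfolding `affVal`. [folklore] -/
theorem affVal_apply (a : σ → k) (b : k) : affVal (a, b) = (∑ j, a j • X j) + C b := rfl

/-- The constant affine form `1`. [folklore] -/
theorem affVal_zero_one : affVal ((0 : σ → k), (1 : k)) = 1 := by
  simp [affVal]

/-- The weighted-sum gate of an affine form: one wire per variable and one for the constant.
[cite: GuptaKamathKayalSaptharishi2016, §1 eq. (1) and §3 (size = wires)] -/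
def affGate (φ : (σ → k) × k) : Gate k σ :=
  .sum ((Finset.univ : Finset σ).toList.map (fun j => (φ.1 j, .var j)) ++ [(φ.2, .const 1)])

/-- An affine gate has `#σ + 1` wires. [cite: GuptaKamathKayalSaptharishi2016, §3] -/
theorem fanIn_affGate (φ : (σ → k) × k) : (affGate φ).fanIn = Fintype.card σ + 1 := by
  simp [affGate, Gate.fanIn, Gate.args, Finset.length_toList]

/-- The operands of an affine gate are variables or constants (no gate references). [folklore] -/
theorem args_affGate (φ : (σ → k) × k) :
    ∀ u ∈ (affGate φ).args, (∃ j, u = Operand.var j) ∨ ∃ c, u = Operand.const c := by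
  intro u hu
  simp only [affGate, Gate.args, List.map_append, List.map_map, List.mem_append, List.mem_map,
    Function.comp, List.map_cons, List.map_nil, List.mem_singleton] at hu
  rcases hu with ⟨j, -, rfl⟩ | rfl
  · exact Or.inl ⟨j, rfl⟩
  · exact Or.inr ⟨1, rfl⟩

omit [CommSemiring k] [Fintype σ] in
/-- Operands of an affine gate refer below any bound. [folklore] -/
theorem refsBelow_of_var_or_const {u : Operand k σ} (n : ℕ)
    (hu : (∃ j, u = Operand.var j) ∨ ∃ c, u = Operand.const c) : u.RefsBelow n := by
  rcases hu with ⟨j, rfl⟩ | ⟨c, rfl⟩ <;> trivial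

omit [CommSemiring k] [Fintype σ] in
/-- Operands of an affine gate have depth `0`. [folklore] -/
theorem depthIn_of_var_or_const {u : Operand k σ} (ds : List ℕ)
    (hu : (∃ j, u = Operand.var j) ∨ ∃ c, u = Operand.const c) : u.depthIn ds = 0 := by
  rcases hu with ⟨j, rfl⟩ | ⟨c, rfl⟩ <;> rfl

/-- An affine gate computes its affine form (against any value list).
[cite: GuptaKamathKayalSaptharishi2016, §1 eq. (1)] -/
theorem eval_affGate (vals : List (MvPolynomial σ k)) (φ : (σ → k) × k) :
    (affGate φ).eval vals = affVal φ := by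
  simp only [affGate, Gate.eval, List.map_append, List.map_map, List.sum_append, List.map_cons,
    List.map_nil, List.sum_cons, List.sum_nil, add_zero, affVal]
  congr 1
  · have : ((fun a : k × Operand k σ => a.1 • a.2.eval vals) ∘ fun j => (φ.1 j, Operand.var j)) =
        fun j => φ.1 j • (X j : MvPolynomial σ k) := by
      funext j; rfl
    rw [this, Finset.sum_map_toList]
  · change φ.2 • (C 1 : MvPolynomial σ k) = C φ.2
    rw [smul_eq_C_mul, C_1, mul_one]

variable (T D : ℕ) (c : Fin T → k) (ℓ : Fin T → Fin D → (σ → k) × k)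

/-- Layer 1 of the `ΣΠΣ` circuit: the affine gate of `ℓ τ π` at index `finProdFinEquiv (τ, π)`.
[cite: GuptaKamathKayalSaptharishi2016, §1 eq. (1)] -/
def layerA : List (Gate k σ) :=
  (List.finRange (T * D)).map fun q => affGate (ℓ (finProdFinEquiv.symm q).1
    (finProdFinEquiv.symm q).2)

/-- Layer 2 of the `ΣΠΣ` circuit: one product gate per term. [cite:
GuptaKamathKayalSaptharishi2016, §1 eq. (1)] -/
def layerB : List (Gate k σ) :=
  (List.finRange T).map fun τ => .prod ((List.finRange D).map fun π =>
    .gate (finProdFinEquiv (τ, π)).val)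

/-- Layer 3 of the `ΣΠΣ` circuit: the weighted output sum. [cite:
GuptaKamathKayalSaptharishi2016, §1 eq. (1)] -/
def topS : Gate k σ :=
  .sum ((List.finRange T).map fun τ => (c τ, .gate (T * D + τ.val)))

/-- The `ΣΠΣ` circuit computing `∑_{τ<T} c_τ ∏_{π<D} ℓ_{τπ}` (GKKS TR13-026 §1, eq. (1)).
[cite: GuptaKamathKayalSaptharishi2016, §1 eq. (1)] -/
def spsCircuit : ArithCircuit k σ where
  gates := layerA T D ℓ ++ layerB T D ++ [topS T D c]
  output := .gate (T * D + T)

/-- Layer 1 has `T · D` gates. [folklore] -/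
theorem length_layerA : (layerA T D ℓ : List (Gate k σ)).length = T * D := by simp [layerA]

omit [CommSemiring k] [Fintype σ] in
/-- Layer 2 has `T` gates. [folklore] -/
theorem length_layerB : (layerB T D : List (Gate k σ)).length = T := by simp [layerB]

/-- Layer 1 refers to no gate. [folklore] -/
theorem refs_layerA (n : ℕ) : ∀ g ∈ (layerA T D ℓ : List (Gate k σ)), ∀ u ∈ g.args,
    u.RefsBelow n := by
  intro g hg u hu
  simp only [layerA, List.mem_map] at hg
  obtain ⟨q, -, rfl⟩ := hg
  exact refsBelow_of_var_or_const n (args_affGate _ u hu)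

/-- Values of layer 1: the affine forms. [folklore] -/
theorem gateValues_layerA : gateValues (layerA T D ℓ : List (Gate k σ)) =
    (List.finRange (T * D)).map fun q => affVal (ℓ (finProdFinEquiv.symm q).1
      (finProdFinEquiv.symm q).2) := by
  have := gateValues_layer (k := k) (σ := σ) [] (layerA T D ℓ) (refs_layerA T D ℓ _)
  simp only [List.nil_append] at this
  rw [this]
  simp [gateValues, layerA, eval_affGate, Function.comp_def]

/-- Layer 2 refers only to layer 1. [folklore] -/
theorem refs_layerB : ∀ g ∈ (layerB T D : List (Gate k σ)), ∀ u ∈ g.args,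
    u.RefsBelow (layerA T D ℓ : List (Gate k σ)).length := by
  intro g hg u hu
  simp only [layerB, List.mem_map] at hg
  obtain ⟨τ, -, rfl⟩ := hg
  simp only [Gate.args, List.mem_map] at hu
  obtain ⟨π, -, rfl⟩ := hu
  simp only [Operand.RefsBelow, length_layerA]
  exact (finProdFinEquiv (τ, π)).isLt

/-- Values of layers 1–2. [folklore] -/
theorem gateValues_layerAB : gateValues (layerA T D ℓ ++ layerB T D : List (Gate k σ)) =
    ((List.finRange (T * D)).map fun q => affVal (ℓ (finProdFinEquiv.symm q).1
      (finProdFinEquiv.symm q).2)) ++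
      (List.finRange T).map fun τ => ∏ π : Fin D, affVal (ℓ τ π) := by
  rw [gateValues_layer _ _ (refs_layerB T D ℓ), gateValues_layerA]
  congr 1
  simp only [layerB, List.map_map]
  apply List.map_congr_left
  intro τ _
  simp only [Function.comp, Gate.eval, List.map_map]
  rw [← Fin.prod_univ_def]
  apply Fintype.prod_congr
  intro π
  simp only [Function.comp, Operand.eval, List.getD_eq_getElem?_getD, List.getElem?_map]
  rw [List.getElem?_eq_getElem (by rw [List.length_finRange]; exact (finProdFinEquiv (τ, π)).isLt)]
  simp only [List.getElem_finRange, Fin.cast_mk, Option.map_some, Option.getD_some, Fin.eta,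
    Equiv.symm_apply_apply]

/-- The output gate refers only to layers 1–2. [folklore] -/
theorem refs_topS : ∀ g ∈ ([topS T D c] : List (Gate k σ)), ∀ u ∈ g.args,
    u.RefsBelow (layerA T D ℓ ++ layerB T D : List (Gate k σ)).length := by
  intro g hg u hu
  simp only [List.mem_singleton] at hg
  subst hg
  simp only [topS, Gate.args, List.map_map, List.mem_map] at hu
  obtain ⟨τ, -, rfl⟩ := hu
  simp only [Function.comp, Operand.RefsBelow, List.length_append, length_layerA, length_layerB]
  omega

/-- **The `ΣΠΣ` circuit computes `∑_τ c_τ ∏_π ℓ_{τπ}`** (GKKS TR13-026 §1, eq. (1)).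
[cite: GuptaKamathKayalSaptharishi2016, §1 eq. (1)] -/
theorem eval_spsCircuit :
    (spsCircuit T D c ℓ).eval = ∑ τ : Fin T, c τ • ∏ π : Fin D, affVal (ℓ τ π) := by
  simp only [spsCircuit, ArithCircuit.eval]
  rw [gateValues_layer _ _ (refs_topS T D c ℓ), gateValues_layerAB T D ℓ]
  set vA := (List.finRange (T * D)).map fun q => affVal (k := k) (ℓ (finProdFinEquiv.symm q).1
    (finProdFinEquiv.symm q).2) with hvA
  set vB := (List.finRange T).map fun τ => ∏ π : Fin D, affVal (k := k) (ℓ τ π) with hvB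
  have hlA : vA.length = T * D := by simp [hvA]
  have hlB : vB.length = T := by simp [hvB]
  have hl2 : (vA ++ vB).length = T * D + T := by rw [List.length_append, hlA, hlB]
  simp only [List.map_singleton, Operand.eval, List.getD_eq_getElem?_getD]
  rw [List.getElem?_append_right (le_of_eq hl2), hl2, Nat.sub_self]
  simp only [List.getElem?_cons_zero, Option.getD_some, topS, Gate.eval, List.map_map]
  rw [← Fin.sum_univ_def]
  apply Fintype.sum_congr
  intro τ
  simp only [Function.comp, Operand.eval, List.getD_eq_getElem?_getD]
  rw [List.getElem?_append_right (by rw [hlA]; omega), hlA, Nat.add_sub_cancel_left, hvB,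
    List.getElem?_map, List.getElem?_eq_getElem (by simp)]
  simp

/-- The `ΣΠΣ` circuit has product-depth `≤ 1`: affine gates have product-depth `0`, the product
gates `1`, and the output sum adds nothing (LST 2021 §1: `ΣΠΣ` circuits are the circuits of
product-depth `1`). [cite: LST2021, §1] -/
theorem productDepth_spsCircuit_le : (spsCircuit T D c ℓ).productDepth ≤ 1 := by
  unfold ArithCircuit.productDepth ArithCircuit.wdepth
  generalize hw : (fun g : Gate k σ => if g.isProd then 1 else 0) = w
  have hw_prod : ∀ args, w (.prod args) = 1 := fun _ => by rw [← hw]; rfl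
  have hw_sum : ∀ args, w (.sum args) = 0 := fun _ => by rw [← hw]; rfl
  have h1 : AllLe 0 (gateWDepths w (layerA T D ℓ : List (Gate k σ))) := by
    have := gateWDepths_layer w [] (layerA T D ℓ) (refs_layerA T D ℓ _)
    simp only [List.nil_append] at this
    rw [this]
    intro x hx
    simp only [gateWDepths, List.foldl_nil, List.nil_append, List.mem_map] at hx
    obtain ⟨g, hg, rfl⟩ := hx
    simp only [layerA, List.mem_map] at hg
    obtain ⟨q, -, rfl⟩ := hg
    rw [affGate, hw_sum, zero_add]
    refine foldr_max_le fun x hx => ?_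
    obtain ⟨u, hu, rfl⟩ := List.mem_map.1 hx
    rw [depthIn_of_var_or_const _ (args_affGate _ u hu)]
  have h2 : AllLe 1 (gateWDepths w (layerA T D ℓ ++ layerB T D : List (Gate k σ))) := by
    rw [gateWDepths_layer w _ _ (refs_layerB T D ℓ)]
    intro x hx
    rcases List.mem_append.1 hx with hx | hx
    · exact (h1 x hx).trans (Nat.zero_le _)
    · simp only [List.mem_map] at hx
      obtain ⟨g, hg, rfl⟩ := hx
      simp only [layerB, List.mem_map] at hg
      obtain ⟨τ, -, rfl⟩ := hg
      rw [hw_prod]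
      have := foldr_max_le (b := 0) (l := ((Gate.prod ((List.finRange D).map fun π =>
        Operand.gate (finProdFinEquiv (τ, π)).val) : Gate k σ).args.map
          (Operand.depthIn (gateWDepths w (layerA T D ℓ))))) fun x hx => by
        obtain ⟨u, -, rfl⟩ := List.mem_map.1 hx
        exact depthIn_le h1 u
      omega
  have h3 : AllLe 1 (gateWDepths w (spsCircuit T D c ℓ).gates) := by
    simp only [spsCircuit]
    rw [gateWDepths_layer w _ _ (refs_topS T D c ℓ)]
    intro x hx
    rcases List.mem_append.1 hx with hx | hx
    · exact h2 x hx
    · simp only [List.map_singleton, List.mem_singleton] at hx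
      subst hx
      rw [topS, hw_sum, zero_add]
      exact foldr_max_le fun x hx => by
        obtain ⟨u, -, rfl⟩ := List.mem_map.1 hx
        exact depthIn_le h2 u
  exact depthIn_le h3 _

/-- **Wire count of the `ΣΠΣ` circuit**: `T · D · (#σ + 1) + T · D + T` (GKKS TR13-026 §3: size
= number of wires; proof of Lemma 4.7: "top fan-in … degree … `(n + 1)`").
[cite: GuptaKamathKayalSaptharishi2016, §3 and Lemma 4.7] -/
theorem edgeSize_spsCircuit :
    (spsCircuit T D c ℓ).edgeSize = T * D * (Fintype.card σ + 1) + T * D + T := by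
  simp only [spsCircuit, ArithCircuit.edgeSize, List.map_append, List.sum_append, layerA,
    layerB, topS, List.map_map, Function.comp_def, fanIn_affGate, List.map_singleton,
    List.sum_singleton]
  simp [Gate.fanIn, Gate.args]

omit [Fintype σ] in
/-- Padding a list of affine forms with the constant form `1` does not change the product.
[folklore] -/
theorem prod_affVal_getD [Fintype σ] (A : List ((σ → k) × k)) (D : ℕ) (hA : A.length ≤ D) :
    ∏ π : Fin D, affVal (A.getD π.val ((0 : σ → k), (1 : k))) = (A.map affVal).prod := by
  have h : ∀ π : Fin D, affVal (A.getD π.val ((0 : σ → k), (1 : k))) =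
      (A.map affVal).getD π.val 1 := by
    intro π
    rw [List.getD_eq_getElem?_getD, List.getD_eq_getElem?_getD, List.getElem?_map]
    cases A[π.val]? with
    | none => simp [affVal_zero_one]
    | some x => rfl
  simp_rw [h]
  exact prod_getD_one _ D (by simpa using hA)

/-- **The `ΣΠΣ` builder, list-fed form**: a family of `#𝒯` terms `c_τ · ∏ (A τ)` with at most `D`
affine factors each is computed by a circuit of product-depth `≤ 1` with at most
`#𝒯 · (D · (#σ + 2) + 1)` wires. [cite: GuptaKamathKayalSaptharishi2016, §1 eq. (1), §3, Lemma 4.7] -/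
theorem exists_sps_circuit {𝒯 : Type*} [Fintype 𝒯] (D : ℕ) (c : 𝒯 → k)
    (A : 𝒯 → List ((σ → k) × k)) (hA : ∀ τ, (A τ).length ≤ D) :
    ∃ C : ArithCircuit k σ, C.eval = ∑ τ, c τ • ((A τ).map affVal).prod ∧
      C.productDepth ≤ 1 ∧ C.edgeSize ≤ Fintype.card 𝒯 * (D * (Fintype.card σ + 2) + 1) := by
  set T := Fintype.card 𝒯 with hT
  set e := Fintype.equivFin 𝒯 with he
  set c' : Fin T → k := fun τ => c (e.symm τ) with hc'
  set ℓ' : Fin T → Fin D → (σ → k) × k := fun τ π => (A (e.symm τ)).getD π.val (0, 1) with hℓ'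
  refine ⟨spsCircuit T D c' ℓ', ?_, productDepth_spsCircuit_le T D c' ℓ', ?_⟩
  · rw [eval_spsCircuit]
    rw [← e.symm.sum_comp]
    refine Fintype.sum_congr _ _ fun τ => ?_
    simp only [hc', hℓ']
    rw [prod_affVal_getD _ _ (hA _)]
  · rw [edgeSize_spsCircuit]
    have : T * D * (Fintype.card σ + 1) + T * D + T = T * (D * (Fintype.card σ + 2) + 1) := by
      ring
    rw [this]

end Builder

/-! ## Renaming preserves wires and product-depth -/

section Rename

omit k σ τ in
/-- Renaming does not change the operand list structure of a gate. [cite: Burgisser2000, Rem. 2.2] -/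
theorem args_rename {k : Type u} {σ : Type v} {τ : Type w} (e : σ → τ) (g : Gate k σ) :
    (g.rename e).args = g.args.map (Operand.rename e) := by
  cases g <;> simp [Gate.rename, Gate.args, List.map_map, Function.comp_def]

/-- Renaming does not change the fan-in of a gate. [cite: Burgisser2000, Rem. 2.2] -/
theorem fanIn_rename (e : σ → τ) (g : Gate k σ) : (g.rename e).fanIn = g.fanIn := by
  simp [Gate.fanIn, args_rename]

/-- Renaming does not change the number of wires. [cite: Burgisser2000, Rem. 2.2] -/
theorem edgeSize_rename (e : σ → τ) (P : ArithCircuit k σ) :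
    (P.rename e).edgeSize = P.edgeSize := by
  simp [ArithCircuit.edgeSize, ArithCircuit.rename, List.map_map, Function.comp_def, fanIn_rename]

/-- Renaming does not change operand depths. [folklore] -/
theorem depthIn_rename (e : σ → τ) (ds : List ℕ) (u : Operand k σ) :
    (u.rename e).depthIn ds = u.depthIn ds := by
  cases u <;> rfl

/-- Renaming does not change whether a gate is a product gate. [folklore] -/
theorem isProd_rename (e : σ → τ) (g : Gate k σ) : (g.rename e).isProd = g.isProd := by
  cases g <;> rfl

/-- Renaming does not change the product-depth list. [folklore] -/
theorem gateWDepths_rename (e : σ → τ) (gs : List (Gate k σ)) :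
    gateWDepths (fun g : Gate k τ => if g.isProd then 1 else 0) (gs.map (Gate.rename e)) =
      gateWDepths (fun g : Gate k σ => if g.isProd then 1 else 0) gs := by
  induction gs using List.reverseRecOn with
  | nil => rfl
  | append_singleton gs g ih =>
    rw [List.map_append, List.map_singleton, gateWDepths_append_singleton,
      gateWDepths_append_singleton, ih, isProd_rename, args_rename, List.map_map]
    have hmap : g.args.map (Operand.depthIn (gateWDepths
        (fun g : Gate k σ => if g.isProd then 1 else 0) gs) ∘ Operand.rename e) =
        g.args.map (Operand.depthIn (gateWDepths
          (fun g : Gate k σ => if g.isProd then 1 else 0) gs)) :=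
      List.map_congr_left fun u _ => depthIn_rename e _ u
    rw [hmap]

/-- Renaming does not change the product-depth. [cite: LST2021, §1] -/
theorem productDepth_rename (e : σ → τ) (P : ArithCircuit k σ) :
    (P.rename e).productDepth = P.productDepth := by
  unfold ArithCircuit.productDepth ArithCircuit.wdepth
  change (P.output.rename e).depthIn (gateWDepths _ (P.gates.map (Gate.rename e))) = _
  rw [gateWDepths_rename, depthIn_rename]

end Rename

/-! ## Restriction to the variables that occur -/

section Restrict

variable [DecidableEq σ]

/-- The variable of an operand, if it is one. [folklore] -/
def varOf : Operand k σ → Option σ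
  | .var j => some j
  | _ => none

/-- The finite set of variables occurring in a circuit (as operands of gates or as the output).
[folklore] -/
def usedVars (P : ArithCircuit k σ) : Finset σ :=
  (P.operands.filterMap varOf).toFinset

/-- At most one variable per operand occurrence: `#usedVars ≤ edgeSize + 1`. [cite:
GuptaKamathKayalSaptharishi2016, §3 (size = number of wires, input wires included)] -/
theorem card_usedVars_le (P : ArithCircuit k σ) : (usedVars P).card ≤ P.edgeSize + 1 := by
  unfold usedVars
  refine (List.toFinset_card_le _).trans ((List.length_filterMap_le _ _).trans ?_)
  simp only [ArithCircuit.operands, List.length_append, List.length_flatMap, List.length_singleton,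
    ArithCircuit.edgeSize]
  rfl

/-- A variable operand of a gate of `P` is a used variable. [folklore] -/
theorem mem_usedVars_of_mem_args {P : ArithCircuit k σ} {g : Gate k σ} (hg : g ∈ P.gates) {j : σ}
    (hj : Operand.var j ∈ g.args) : j ∈ usedVars P := by
  unfold usedVars
  rw [List.mem_toFinset, List.mem_filterMap]
  refine ⟨Operand.var j, ?_, rfl⟩
  simp only [ArithCircuit.operands, List.mem_append, List.mem_flatMap, List.mem_singleton]
  exact Or.inl ⟨g, hg, hj⟩

/-- The output variable of `P`, if any, is a used variable. [folklore] -/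
theorem mem_usedVars_of_output {P : ArithCircuit k σ} {j : σ} (hj : P.output = Operand.var j) :
    j ∈ usedVars P := by
  unfold usedVars
  rw [List.mem_toFinset, List.mem_filterMap]
  refine ⟨Operand.var j, ?_, rfl⟩
  simp [ArithCircuit.operands, hj]

variable (V : Finset σ) [Zero k]

/-- Restriction of an operand to the variable set `V` (variables outside `V` become the junk
constant `0`; unreachable when `V ⊇ usedVars`). [folklore] -/
def restrictOperand : Operand k σ → Operand k {x // x ∈ V}
  | .var j => if h : j ∈ V then .var ⟨j, h⟩ else .const 0
  | .const c => .const c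
  | .gate i => .gate i

/-- Restriction of a gate to the variable set `V`. [folklore] -/
def restrictGate : Gate k σ → Gate k {x // x ∈ V}
  | .sum args => .sum (args.map fun a => (a.1, restrictOperand V a.2))
  | .prod args => .prod (args.map (restrictOperand V))

/-- Restriction of a circuit to the variable set `V`. [folklore] -/
def restrict (P : ArithCircuit k σ) : ArithCircuit k {x // x ∈ V} where
  gates := P.gates.map (restrictGate V)
  output := restrictOperand V P.output

omit [Zero k] in
/-- Renaming a restricted operand back gives the operand, if its variable lies in `V`.
[folklore] -/
theorem rename_restrictOperand [Zero k] {u : Operand k σ} (hu : ∀ j, u = Operand.var j → j ∈ V) :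
    (restrictOperand V u).rename Subtype.val = u := by
  cases u with
  | var j => simp [restrictOperand, dif_pos (hu j rfl), Operand.rename]
  | const c => rfl
  | gate i => rfl

omit [Zero k] in
/-- Renaming a restricted gate back gives the gate, if its variables lie in `V`. [folklore] -/
theorem rename_restrictGate [Zero k] {g : Gate k σ}
    (hg : ∀ j, Operand.var j ∈ g.args → j ∈ V) :
    (restrictGate V g).rename Subtype.val = g := by
  cases g with
  | sum args =>
    simp only [restrictGate, Gate.rename, List.map_map, Gate.sum.injEq]
    conv_rhs => rw [← List.map_id args]
    apply List.map_congr_left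
    intro a ha
    simp only [Function.comp, id]
    rw [rename_restrictOperand V fun j hj => hg j ?_]
    simp only [Gate.args, List.mem_map]
    exact ⟨a, ha, by rw [hj]⟩
  | prod args =>
    simp only [restrictGate, Gate.rename, List.map_map, Gate.prod.injEq]
    conv_rhs => rw [← List.map_id args]
    apply List.map_congr_left
    intro u hu
    simp only [Function.comp, id]
    exact rename_restrictOperand V fun j hj => hg j (by rw [← hj]; exact hu)

omit [Zero k] V in
/-- **Restriction to the used variables**: every circuit is the renaming along `Subtype.val` of
its restriction to `usedVars`. [cite: Burgisser2000, Rem. 2.2] -/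
theorem rename_restrict [Zero k] (P : ArithCircuit k σ) :
    (restrict (usedVars P) P).rename Subtype.val = P := by
  cases P with
  | mk gates output =>
    simp only [restrict, ArithCircuit.rename, List.map_map, ArithCircuit.mk.injEq]
    constructor
    · conv_rhs => rw [← List.map_id gates]
      apply List.map_congr_left
      intro g hg
      simp only [Function.comp, id]
      exact rename_restrictGate _ fun j hj => mem_usedVars_of_mem_args (P := ⟨gates, output⟩) hg hj
    · exact rename_restrictOperand _ fun j hj => mem_usedVars_of_output (P := ⟨gates, output⟩) hj

omit [Zero k] V in
/-- The restriction has the same number of gates. [folklore] -/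
theorem size_restrict [Zero k] (W : Finset σ) (P : ArithCircuit k σ) :
    (restrict W P).size = P.size := by
  simp [restrict, ArithCircuit.size]

omit [Zero k] V in
/-- The restriction of a fan-in-two circuit has fan-in two. [folklore] -/
theorem isFanInTwo_restrict [Zero k] (W : Finset σ) {P : ArithCircuit k σ} (h : P.IsFanInTwo) :
    (restrict W P).IsFanInTwo := by
  intro g hg
  simp only [restrict, List.mem_map] at hg
  obtain ⟨g', hg', rfl⟩ := hg
  have : (restrictGate W g').fanIn = g'.fanIn := by
    cases g' <;> simp [restrictGate, Gate.fanIn, Gate.args]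
  rw [this]
  exact h g' hg'

omit [Zero k] V in
/-- **Every circuit lives on few variables**: a circuit `P` over `σ` is the renaming along an
injection of a circuit `P'` of the same size over a finite variable type of cardinality
`≤ edgeSize P + 1`, fan-in two if `P` is; in particular `P.eval = rename val P'.eval`.
[cite: Burgisser2000, Rem. 2.2; GuptaKamathKayalSaptharishi2016, §3] -/
theorem exists_restrict [CommSemiring k] (P : ArithCircuit k σ) :
    ∃ (V : Finset σ) (P' : ArithCircuit k {x // x ∈ V}),
      V.card ≤ P.edgeSize + 1 ∧ P'.size = P.size ∧ (P.IsFanInTwo → P'.IsFanInTwo) ∧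
        P.eval = MvPolynomial.rename Subtype.val P'.eval := by
  refine ⟨usedVars P, restrict (usedVars P) P, card_usedVars_le P, size_restrict _ P,
    isFanInTwo_restrict _, ?_⟩
  conv_lhs => rw [← rename_restrict P]
  exact eval_rename_apply _ _

end Restrict

/-! ## Degree and support bounds -/

section Degree

variable [CommSemiring k]

/-- Renaming along an injection preserves the total degree. [folklore] -/
theorem totalDegree_rename_of_injective {e : σ → τ} (he : Function.Injective e)
    (p : MvPolynomial σ k) : (MvPolynomial.rename e p).totalDegree = p.totalDegree := by
  classical
  refine le_antisymm (totalDegree_rename_le e p) (Finset.sup_le fun s hs => ?_)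
  have hmem : Finsupp.mapDomain e s ∈ (MvPolynomial.rename e p).support := by
    rw [support_rename_of_injective he]
    exact Finset.mem_image_of_mem _ hs
  have hdeg : ((Finsupp.mapDomain e s).sum fun _ n => n) = s.sum fun _ n => n :=
    Finsupp.sum_mapDomain_index_inj he
  rw [← hdeg]
  exact le_totalDegree hmem

/-- Renaming along an injection preserves the number of monomials. [folklore] -/
theorem card_support_rename_of_injective {e : σ → τ} (he : Function.Injective e)
    (p : MvPolynomial σ k) : (MvPolynomial.rename e p).support.card = p.support.card := by
  classical
  rw [support_rename_of_injective he]
  exact Finset.card_image_of_injective _ (Finsupp.mapDomain_injective he)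

/-- Over `#σ` variables there are at most `(D + 1)^{#σ}` monomials of degree `≤ D`, so a
polynomial of degree `≤ D` has at most that many monomials. [folklore] -/
theorem card_support_le_pow_of_totalDegree_le [Fintype σ] [DecidableEq σ] {p : MvPolynomial σ k}
    {D : ℕ} (hp : p.totalDegree ≤ D) : p.support.card ≤ (D + 1) ^ Fintype.card σ := by
  have hb : ∀ m ∈ p.support, ∀ v, m v < D + 1 := by
    intro m hm v
    refine Nat.lt_succ_of_le (le_trans ?_ ((le_totalDegree hm).trans hp))
    by_cases hv : v ∈ m.support
    · exact Finset.single_le_sum (f := fun v => m v) (fun _ _ => Nat.zero_le _) hv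
    · rw [Finsupp.notMem_support_iff.1 hv]; exact Nat.zero_le _
  let F : (σ →₀ ℕ) → (σ → Fin (D + 1)) := fun m v =>
    ⟨min (m v) D, Nat.lt_succ_of_le (min_le_right _ _)⟩
  have hinj : Set.InjOn F p.support := by
    intro m hm m' hm' h
    ext v
    have := congrArg (fun g => (g v : ℕ)) h
    simp only [F] at this
    rwa [min_eq_left (Nat.le_of_lt_succ (hb m hm v)),
      min_eq_left (Nat.le_of_lt_succ (hb m' hm' v))] at this
  calc p.support.card ≤ (Finset.univ : Finset (σ → Fin (D + 1))).card :=
        Finset.card_le_card_of_injOn F (fun _ _ => Finset.mem_univ _) hinj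
    _ = (D + 1) ^ Fintype.card σ := by
        rw [Finset.card_univ, Fintype.card_fun, Fintype.card_fin]

end Degree

end Literature.Computability.AlgebraicComplexity.DepthThreeChasm
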